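/-
Copyright (c) 2026 the pub-hodgecm-mathlib formalisation cell (harness21).  Typer seat hodgecm-mathlib-TN-t09 (g2), carpet-typing squad
TN «LN ∕ LS transfer» (SEATPLAN-GO500 v1 §2; TN-plan DEAL v8, 2026-09-02).
-/
import Mathlib.Algebra.Group.Subgroup.Pointwise
import Mathlib.GroupTheory.DoubleCoset
import Mathlib.GroupTheory.Subgroup.Centralizer
import Mathlib.Analysis.Complex.Basic
import Mathlib.Algebra.BigOperators.Finprod
import Mathlib.LinearAlgebra.Matrix.SpecialLinearGroup
import HarnessLib

/-!
# Shelstad (1979), §2 «Inner forms and Cartan subgroups» and §3 «Characters» — the numbered statements as named facts,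
# with the §2 carriers (`𝒜(T)`, `𝒟(T)`, `ψ_x`, «originates from», Cayley transforms) as REAL definitions

D. Shelstad, *Characters and inner forms of a quasi-split group over ℝ*, Compositio Math. **39** (1979) 11–45 [Shelstad1979],
§2 = pp. 12–16, §3 = pp. 16–20.  PAGE PINS «(p. N)» are the printed Compositio pages.  Text: NUMDAM scan
`http://www.numdam.org/article/CM_1979__39_1_11_0.pdf` (`lit read` key `paper:url-551fef475f69`, file `pNNNN.txt` = printed
p. NNNN+9); the OCR layer drops every displayed formula, so all displays were read on the page IMAGES decoded from the same PDF
(`T/LNS/TN-t03/g3/pages-Shelstad1979/pNNNN_{top,bot}.png` in the HCML cell; e.g. Prop. 2.7 on `p0006_bot.png`).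
Squad TN (HCML «GO 500»), DEAL v8 row TN-t09 (g2).  Topic `NumberTheory/Automorphic/Shelstad1979`, namespace
`Literature.NumberTheory.Automorphic.Shelstad1979.InnerFormsAndCharacters`.  STATEMENTS (named facts `def … : Prop`) + REAL
definitions + seven short THEOREMS discharging the items that are formal in the dress; no `sorry`, no `axiom`, no `instance`, no
`notation`.  Sibling: `…/Shelstad1979/StableOrbitalIntegrals.lean` (§4, seat TN-t03 g3) takes the §2 notions as binders; this
file gives them bodies; `…/Shelstad1979/Correspondences.lean` (§§5–6, seat TN-t08 g4) types Theorem 6.3 = the identity announced at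
the end of §3, which is therefore cited below, not restated.

## The dress (read this first)
Print's bold `G` is the complex group `G(ℂ)` of a connected reductive `ℝ`-group and the lightface `G = G(ℝ)`; «the bar denotes
the action of complex conjugation» (p. 13).  Mathlib has no real reductive groups, so, as in the squad's ★
`LanglandsShelstad1987/Defs.lean` and ★ `LabesseLanglands1979/Sec2.lean`:
* ONE abstract group `GC` stands for `G(ℂ)` and a group automorphism `σ : GC ≃* GC` for complex conjugation on it; the real
  group is the fixed subgroup `realPoints σ` («`G`»); a morphism `f` «is defined over `ℝ`» on a `σ`-stable set `S` iff it
  commutes with the conjugations there (`IsDefinedOverOn`), which is how print tests it (proof of Thm 2.1, p. 13: «`x̄tx̄⁻¹ =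
  xtx⁻¹, t ∈ T`»);
* a maximal torus `T` defined over `ℝ` is a `σ`-stable subgroup `TC ≤ GC` (a PARAMETER: «maximal torus», «`ℝ`-split»,
  «anisotropic» have no abstract-group model; where a proof below needs `σ(TC) = TC` it is an explicit hypothesis), its Cartan
  subgroup is `cartan σ TC = TC ⊓ G`; the maximal `ℝ`-split subtorus `S(T)` and `M = Cent(G, S(T))` are parameters `SC`, `MC`;
* characters ∕ roots of `T` are functions `GC → ℂ` read on `TC`, with the Galois action `(σ·χ)(t) = conj (χ(σ⁻¹ t))`, so «real»
  = `IsRealOn`, «imaginary» = `IsImaginaryOn` (p. 12: «we follow the usual definitions of real, imaginary … and complex roots»);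
  a Weyl element `ω ∈ Ω(G,T)` is given by its action `w : GC → GC` on `TC` and «`n` realizes `ω`» is `Realizes` (p. 12);
* the inner twist is `ψ : GC ≃* GC'` with `σ'` on `GC'`, `ψ̄ = σ' ∘ ψ ∘ σ⁻¹` (`barIso`), `ψ_x = ad x ∘ ψ` (`psiX`);
* §3's representation-theoretic objects (`Π(G)`, `Φ(G)`, `Π_φ`, tempered, `χ(π)`, `χ_φ`, `φ ↦ φ'`) form the DATA-ONLY carrier
  `LPacketData` (no `Prop` fields); print's assertions about them are predicates on a carrier value.
**Every numbered item is a `def … : Prop`.**  Two kinds (squad COORDINATION NOTE 1 (b)): PREDICATES on explicit parameters —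
print asserts them for ITS data, `∀ data, …` is never claimed — and CLOSED facts (universally quantified, formal in the dress),
each CLOSED fact being PROVED in the section `Discharges` at the end (`…_holds`), so the file adds no unproved closed fact.

## Census «what the tree states §§2–3 as» (`rg 'cite: Shelstad1979'` over `lean/Literature`, `lean/Summits`, 2026-09-02)
99 tags in 41 files, ALL locating §4 (p. 20, Thm 4.1, Thm 4.7) or §§5–6 — see the sibling's census.  Nothing in the tree
states a §2 or §3 item; the notions «originates from», `𝒟(T)`, `(−1)^{q_G − q_{G'}}` occur only as prose inside the §4
consumers (★ `Rogawski1990.ArchInnerTransferCompatible`, ★ `…IsInnerTransferRel`: Rogawski's `γ' ↔ γ` «corresponding regular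
pairs» is print's «originates from» for `(U(3)-inner form, U(2,1))`).  `lean search` for `Cayley transform`, `inner form`,
`stable conjugacy` (real groups): no abstract declaration (the tree's `IsStablyConjugate…` are the `p`-adic `U(3)` model of
★ `Rogawski1990.StableConjugacyU3`).  Hence every declaration below is new; no restatement.

## Index (print item ↦ declaration ↦ page)
| print | declaration | kind | p. |
|---|---|---|---|
| `G = G(ℝ)`; «defined over `ℝ`» | `realPoints`, `IsDefinedOverOn` | REAL | 12–13 |
| «`w` realizes `ω`», `Ω(G,T) ⊂ Ω(G,T)` realized in `G` | `Realizes`, `IsRealizedInG` | REAL | 12 |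
| `𝒜(T) = {g ∈ G : ad g∣T defined over ℝ}` «= `{g : gTg⁻¹ ⊂ G}`» | `cartan`, `scriptA`, `conjIntoG`; `Shelstad1979_2_scriptA_subset` (CLOSED, proved), `Shelstad1979_2_scriptA_eq_conjIntoG` (PRED.) | REAL ∕ facts | 13 |
| **Theorem 2.1** `𝒜(T) = G · Norm(M, T)`, `M = Cent(G, S(T))` | `leviM`, `normMT` (REAL); `Shelstad1979_2_1_scriptA_eq` | PREDICATE | 13 |
| **Proposition 2.2** (anisotropic torus: every rational automorphism is defined over `ℝ`) | `Shelstad1979_2_2_anisotropicAut` | CLOSED, proved | 14 |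
| **Corollary 2.3** | `Shelstad1979_2_3_conjugate` | PREDICATE | 14 |
| **Corollary 2.4** | `Shelstad1979_2_4_realizedInG` | PREDICATE | 14 |
| `𝒟(T) = G∖𝒜(T)∕T` | `scriptD` | REAL | 14 |
| **Corollary 2.5** `𝒟(T) = Norm(M,T)∖Norm(M,T)∕T`; «`𝒟(T)` is finite» | `Shelstad1979_2_5_scriptD_eq`, `Shelstad1979_2_5_finite` | PREDICATE | 14 |
| inner forms: `ψ̄ψ⁻¹` inner; `ψ_x`; the lemma of [18] | `IsInner`, `barIso`, `IsInnerFormVia`, `psiX`; `Shelstad1979_2_embedCartan` | REAL ∕ PRED. | 13 |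
| «`ψ_y∣T` is defined over `ℝ` iff `yx⁻¹ ∈ 𝒜(T')`» | `Shelstad1979_2_psiY_iff` | CLOSED, proved | 14 |
| `ψᵗ : t(G) → t(G')` well defined, an embedding; the order `≤` on `t(G)` | `Shelstad1979_2_psiT_wellDefined`, `Shelstad1979_2_psiT_injective`; `cartanLE` | PRED. ∕ REAL | 13–15 |
| real ∕ imaginary ∕ complex roots (characters) | `IsRealOn`, `IsImaginaryOn`, `IsComplexOn` | REAL | 12, 15 |
| Cayley transform w.r.t. `α`; `T_s = sTs⁻¹`; standard Cayley transform | `IsCayleyTransform`, `cayleyTorus`, `cayleyMatrix`, `IsStandardCayley` | REAL | 15 |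
| **Proposition 2.7** (1) `T_s` defined over `ℝ`, `sα` real; (2); (3) | `Shelstad1979_2_7_1_torusDefinedOver`, `Shelstad1979_2_7_1_rootReal` (CLOSED, proved); `Shelstad1979_2_7_2_splitPart`, `Shelstad1979_2_7_3_product` (PRED.) | facts | 15 |
| «`S(T_s)` conjugate to a codim-1 subtorus»; «`⟨T⟩ ≤ ⟨U⟩` iff a sequence of Cayley transforms» | `cayleyChain`, `Shelstad1979_2_le_iff_cayleyChain` | REAL ∕ PRED. | 15–16 |
| **Lemma 2.8** (1), (2), (3) | `Shelstad1979_2_8_1_monotone`, `Shelstad1979_2_8_2_initialSegment`, `Shelstad1979_2_8_3_fundamental` | PREDICATE | 16 |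
| **Corollary 2.9** | `Shelstad1979_2_9_compactCartan` | PREDICATE | 16 |
| `G_reg`, `T_γ`, «`γ'` originates from `γ`»; «also from `γ^w`, `w ∈ 𝒜(T_γ)`, and only from these» | `OriginatesFrom`; `Shelstad1979_2_originates_conj`, `Shelstad1979_2_originates_conj'` (CLOSED, proved), `Shelstad1979_2_originates_only`, `Shelstad1979_2_originates_only'` (PRED.) | REAL ∕ facts | 16 |
| §3: `Π(G)`, `Φ(G)`, `Π_φ`, tempered, `φ ↦ φ'`, `χ(π)`, `χ_φ` | `LPacketData`, `LPacketData.IsTemperedParam` | carrier | 16–18 |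
| «`Φ(G)` partitions `Π(G)` into finite subsets `Π_φ`»; «all tempered or none» [18, p. 40]; «`Φ(G) ↪ Φ(G')`», «`φ'` tempered iff `φ`» | `Shelstad1979_3_packets_partition`, `Shelstad1979_3_tempered_allOrNone`, `Shelstad1979_3_paramMap_embedding` | PREDICATE | 16–17 |
| `⟨Λ⟩ = {Λ ∘ ad g⁻¹ ; g ∈ 𝒜(T)}`; tempered `φ` ↔ orbits `⟨Λ⟩`; `Λ' = Λ ∘ ψ_x⁻¹` | `charOrbit`, `transportChar`; `Shelstad1979_3_orbitCorrespondence`, `Shelstad1979_3_orbitTransport` | REAL ∕ PRED. | 18 |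
| **Lemma 3.1** `χ_φ = Σ_{π ∈ Π_φ} χ(π)` | `Shelstad1979_3_1_charSum` | PREDICATE | 18 |
| **Lemma 3.2** | `IndData`, `Shelstad1979_3_2_inducedEquivalent` | carrier ∕ PRED. | 18 |
| display **(1)** `g(λ + ι) = ω₀ω(λ + ι)` | `Shelstad1979_3_eq_1` | PREDICATE | 19 |
| `2q_G`; «`q_{G'} − q_G` is an integer» | `Shelstad1979_3_qDiff_integer` | PREDICATE | 20 |
| the character identity `χ_{φ'}(γ') = (−1)^{q_{G'} − q_G} χ_φ(γ)` (= Thm 6.3) | ★ `…Shelstad1979.Correspondences.Shelstad1979_6_3_characterIdentity` (CITED, not restated) | — | 19–20 |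

NOT TYPED (census): the proofs (pp. 13–19); the parabolic-subgroup argument of Thm 2.1; the Lie-algebra definition of
compact ∕ noncompact imaginary roots through root vectors `X_{±α}`, the Killing form and the lifts `SU(2) → G`, `SL₂ → G`
(p. 15) — no real-form ∕ root-vector vocabulary in Mathlib; «compact» enters below only through the EXISTENCE of a Cayley
transform (p. 37, Prop. 4.11) and as the parameter `IsFundamental` ∕ `S(T) = 1`; the construction of `Π_φ` from `(P₀, M₀, T₀)`,
`X(φ)`, `π(λ, ι)`, `π(Λ, ι) = Ind(π(λ, ι) ⊗ Λ∣Z_M, Z_M M†, M)` and the representatives `{π(ωΛ, ωι) ; ω ∈ Ω(M,T)∖Ω(M,T)}` (pp. 17–18;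
Harish-Chandra discrete series [5], parabolic induction — no `(𝔤, K)`-module vocabulary in Mathlib); the remark «`η = θψι`,
`ηᵗ = θᵗψᵗ`» (pp. 13, 15) and «every `G` is an inner form of some quasi-split group [21]» (p. 13).

## References
* [Shelstad1979] D. Shelstad, *Characters and inner forms of a quasi-split group over ℝ*, Compositio Math. 39 (1979) 11–45:
  §2 pp. 12–16 (Thm 2.1 p. 13; Prop 2.2, Cor 2.3–2.5 p. 14; Prop 2.7 p. 15; Lemma 2.8, Cor 2.9 p. 16), §3 pp. 16–20 (Lemma 3.1,
  Lemma 3.2 p. 18; (1) p. 19; the identity pp. 19–20); NUMDAM `CM_1979__39_1_11_0`.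
* [18] = R. P. Langlands, *On the classification of irreducible representations of real algebraic groups* (the lemma embedding
  Cartan subgroups, p. 13; `Φ(G)`, p. 16; «page 40», «page 65»); [19] = R. P. Langlands, *Stable conjugacy: definitions and
  lemmas* (`𝒜(T)`, `𝒟(T)`); [26] = G. Warner, *Harmonic analysis on semi-simple Lie groups* (fundamental Cartan subgroups;
  «volume 2, page 225» for `q_{G'} − q_G ∈ ℤ`); [5] = Harish-Chandra, discrete series; [13] = multiplicity one for unitary
  principal series; [14], [15] = Knapp–Zuckerman — as numbered in the source's bibliography (pp. 44–45).
-/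

noncomputable section

open scoped Pointwise

namespace Literature.NumberTheory.Automorphic.Shelstad1979.InnerFormsAndCharacters

universe u u' v w

/-! ## §2, pp. 12–13: the real structure, `G = G(ℝ)`, «defined over `ℝ`», Weyl elements realized in `G` -/

section RealStructure

variable {GC : Type u} [Group GC] {GC' : Type u'} [Group GC']

/-- `G = G(ℝ)`, the real points: the subgroup of `GC` = «`G`» `= G(ℂ)` fixed by complex conjugation `σ` (p. 12: «`G = G(ℝ)` is
a reductive Lie group»). [cite: Shelstad1979, §2 (p. 12)] -/
def realPoints (σ : GC ≃* GC) : Subgroup GC :=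
  MonoidHom.eqLocus σ.toMonoidHom (MonoidHom.id GC)

/-- Unfolding of `realPoints`: `g ∈ G ⇔ ḡ = g` (p. 12). [cite: Shelstad1979, §2 (p. 12)] -/
theorem mem_realPoints {σ : GC ≃* GC} {g : GC} : g ∈ realPoints σ ↔ σ g = g := Iff.rfl

/-- «The restriction of `f` to `S` is defined over `ℝ`» for a map `f : G(ℂ) → G'(ℂ)` of complex groups with conjugations `σ`,
`σ'` and a `σ`-stable set `S`: `f` commutes with the conjugations on `S` (the test used on p. 13, proof of Thm 2.1, and p. 14:
«`ψ_y∣T` is defined over `ℝ` if and only if …»). [cite: Shelstad1979, §2 (pp. 13–14)] -/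
def IsDefinedOverOn (σ : GC ≃* GC) (σ' : GC' ≃* GC') (f : GC → GC') (S : Set GC) : Prop :=
  ∀ s ∈ S, f (σ s) = σ' (f s)

/-- «We say that `w ∈ G` realizes `ω ∈ Ω(G, T)` if `Ad w∣𝔱` coincides with `ω`» (p. 12), group version: `n` normalizes `TC`
and acts on it as the given map `w` (the Weyl element as a map on `T(ℂ)`). [cite: Shelstad1979, §2 (p. 12)] -/
def Realizes (TC : Subgroup GC) (w : GC → GC) (n : GC) : Prop :=
  n ∈ Subgroup.normalizer (TC : Set GC) ∧ ∀ t ∈ TC, n * t * n⁻¹ = w t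

/-- `Ω(G, T)` ⊂ `Ω(G, T)`: «the set of those elements of `Ω(G, T)` which can be realized in `G`» (p. 12) — as a predicate on
the Weyl element `w`. [cite: Shelstad1979, §2 (p. 12)] -/
def IsRealizedInG (σ : GC ≃* GC) (TC : Subgroup GC) (w : GC → GC) : Prop :=
  ∃ n ∈ realPoints σ, Realizes TC w n

end RealStructure

/-! ## §2, pp. 13–14: `𝒜(T)`, Theorem 2.1, Proposition 2.2, Corollaries 2.3–2.5, `𝒟(T)` -/

section ScriptA

variable {GC : Type u} [Group GC]

/-- The Cartan subgroup `T = T(ℝ) = TC ∩ G` of `G` attached to the maximal torus `TC` = «`T`» defined over `ℝ` (p. 12: «A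
Cartan subgroup `T` of `G` … is the group of `ℝ`-rational points on some maximal torus `T` in `G`, defined over `ℝ`»).
[cite: Shelstad1979, §2 (p. 12)] -/
def cartan (σ : GC ≃* GC) (TC : Subgroup GC) : Subgroup GC := TC ⊓ realPoints σ

/-- **`𝒜(T)`** `= {g ∈ G ; ad g∣T is defined over ℝ}` (p. 13, «a definition from [19]»): the `g ∈ G(ℂ)` whose conjugation
commutes with complex conjugation on `T(ℂ)`. [cite: Shelstad1979, §2 (p. 13)] -/
def scriptA (σ : GC ≃* GC) (TC : Subgroup GC) : Set GC :=
  {g | IsDefinedOverOn σ σ (fun t => g * t * g⁻¹) TC}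

/-- Unfolding of `scriptA`: `g ∈ 𝒜(T) ⇔ g σ(t) g⁻¹ = σ(g t g⁻¹)` for `t ∈ T(ℂ)` (p. 13: «`x̄tx̄⁻¹ = xtx⁻¹`»).
[cite: Shelstad1979, §2 (p. 13)] -/
theorem mem_scriptA {σ : GC ≃* GC} {TC : Subgroup GC} {g : GC} :
    g ∈ scriptA σ TC ↔ ∀ t ∈ TC, g * σ t * g⁻¹ = σ (g * t * g⁻¹) := Iff.rfl

/-- `{g ∈ G : gTg⁻¹ ⊂ G}` (p. 13), print's second description of `𝒜(T)`. [cite: Shelstad1979, §2 (p. 13)] -/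
def conjIntoG (σ : GC ≃* GC) (TC : Subgroup GC) : Set GC :=
  {g | ∀ t ∈ cartan σ TC, g * t * g⁻¹ ∈ realPoints σ}

/-- p. 13: «This [`𝒜(T)`] is easily seen to be the same as `{g ∈ G : gTg⁻¹ ⊂ G}`» — the inclusion `𝒜(T) ⊂ {g : gTg⁻¹ ⊂ G}`,
CLOSED (formal; proved below as `…_holds`). [cite: Shelstad1979, §2 (p. 13)] -/
def Shelstad1979_2_scriptA_subset : Prop :=
  ∀ {GC : Type u} [Group GC] (σ : GC ≃* GC) (TC : Subgroup GC), scriptA σ TC ⊆ conjIntoG σ TC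

/-- p. 13: «This is easily seen to be the same as `{g ∈ G : gTg⁻¹ ⊂ G}`» — the equality `𝒜(T) = {g : gTg⁻¹ ⊂ G}`, PREDICATE on
print's data (the reverse inclusion uses that `T = T(ℝ)` is Zariski-dense in `T`, not an abstract-group fact).
[cite: Shelstad1979, §2 (p. 13)] -/
def Shelstad1979_2_scriptA_eq_conjIntoG (σ : GC ≃* GC) (TC : Subgroup GC) : Prop :=
  scriptA σ TC = conjIntoG σ TC

/-- `M` = «the centralizer in `G` of `S(T)`» (Thm 2.1, p. 13), on complex points, for `SC` = «`S(T)`, the maximal `ℝ`-split torus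
in `T`» (p. 13; a PARAMETER — «`ℝ`-split» has no abstract-group model). [cite: Shelstad1979, Theorem 2.1 (p. 13)] -/
def leviM (SC : Subgroup GC) : Subgroup GC := Subgroup.centralizer (SC : Set GC)

/-- `Norm(M, T)`, «the normalizer of `T` in `M`» (Thm 2.1, p. 13), on complex points: `M ∩ Norm(T)`.
[cite: Shelstad1979, Theorem 2.1 (p. 13)] -/
def normMT (SC TC : Subgroup GC) : Subgroup GC := leviM SC ⊓ Subgroup.normalizer (TC : Set GC)

/-- **Theorem 2.1** (p. 13): «Let `M` be the centralizer in `G` of `S(T)`. Then `𝒜(T) = G · Norm(M, T)` where `Norm(M, T)`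
denotes the normalizer of `T` in `M`.»  PREDICATE on print's data `(G(ℂ), σ, T, S(T))`; the right side is the set product
`G · Norm(M, T)` in `G(ℂ)`. [cite: Shelstad1979, Theorem 2.1 (p. 13)] -/
def Shelstad1979_2_1_scriptA_eq (σ : GC ≃* GC) (TC SC : Subgroup GC) : Prop :=
  scriptA σ TC = (realPoints σ : Set GC) * (normMT SC TC : Set GC)

/-- **Proposition 2.2** (p. 14): «Suppose that `T` is a torus defined and anisotropic over `ℝ`. Then every (rational)
automorphism of `T` is defined over `ℝ`.»  LATTICE CURRENCY (print's own proof: «There is a unique automorphism `φ^∨` of the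
group `L` of rational characters on `T` … On the other hand, `λ̄ = −λ, λ ∈ L`. This implies that `φ̄^∨ = φ^∨` and so `φ̄ = φ`»):
for the character group `L` with conjugation `σL` acting as `−1` (anisotropy), every automorphism `φ^∨` of `L` commutes with
`σL`.  CLOSED (proved below). [cite: Shelstad1979, Proposition 2.2 (p. 14)] -/
def Shelstad1979_2_2_anisotropicAut : Prop :=
  ∀ {L : Type v} [AddCommGroup L] (σL : L ≃+ L), (∀ l, σL l = -l) → ∀ (φ : L ≃+ L) (l : L), φ (σL l) = σL (φ l)

/-- **Corollary 2.3** (p. 14): «If `g ∈ 𝒜(T)` then `gTg⁻¹` is `G`-conjugate to `T`.»  PREDICATE on print's data `(G(ℂ), σ, T)`.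
[cite: Shelstad1979, Corollary 2.3 (p. 14)] -/
def Shelstad1979_2_3_conjugate (σ : GC ≃* GC) (TC : Subgroup GC) : Prop :=
  ∀ g ∈ scriptA σ TC, ∃ h ∈ realPoints σ,
    (cartan σ TC).map (MulAut.conj g).toMonoidHom = (cartan σ TC).map (MulAut.conj h).toMonoidHom

/-- **Corollary 2.4** (p. 14): «If `T` contains a maximal `ℝ`-split torus in `G` then the action of an element in `𝒜(T)` on `T`
can be realized in `G`.»  PREDICATE on print's data; the hypothesis «`T` contains a maximal `ℝ`-split torus of `G`» is on the
datum `TC`. [cite: Shelstad1979, Corollary 2.4 (p. 14)] -/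
def Shelstad1979_2_4_realizedInG (σ : GC ≃* GC) (TC : Subgroup GC) : Prop :=
  ∀ g ∈ scriptA σ TC, ∃ h ∈ realPoints σ, ∀ t ∈ TC, h * t * h⁻¹ = g * t * g⁻¹

/-- **`𝒟(T)`** `= G∖𝒜(T)∕T` (p. 14, «as in [19]»): the image of `𝒜(T)` in the double-coset space `G∖G(ℂ)∕T(ℂ)`
(Mathlib `DoubleCoset.Quotient`). [cite: Shelstad1979, §2 (p. 14)] -/
def scriptD (σ : GC ≃* GC) (TC : Subgroup GC) : Set (DoubleCoset.Quotient (realPoints σ : Set GC) (TC : Set GC)) :=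
  DoubleCoset.mk (realPoints σ) TC '' scriptA σ TC

/-- **Corollary 2.5** (p. 14): «`𝒟(T) = Norm(M, T)∖Norm(M, T)∕T`» — the classes of the `n ∈ Norm(M, T)` lie in `𝒟(T)`, every
class of `𝒟(T)` has such a representative, and two such represent the same class iff they differ by `Norm(M, T) = G ∩ Norm(M, T)`
on the left and `T` on the right.  PREDICATE on print's data (`SC` = `S(T)` as in Thm 2.1). [cite: Shelstad1979, Corollary 2.5 (p. 14)] -/
def Shelstad1979_2_5_scriptD_eq (σ : GC ≃* GC) (TC SC : Subgroup GC) : Prop :=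
  (∀ n ∈ normMT SC TC, DoubleCoset.mk (realPoints σ) TC n ∈ scriptD σ TC) ∧
    (∀ d ∈ scriptD σ TC, ∃ n ∈ normMT SC TC, DoubleCoset.mk (realPoints σ) TC n = d) ∧
    ∀ n₁ ∈ normMT SC TC, ∀ n₂ ∈ normMT SC TC,
      DoubleCoset.mk (realPoints σ) TC n₁ = DoubleCoset.mk (realPoints σ) TC n₂ ↔
        ∃ m ∈ normMT SC TC ⊓ realPoints σ, ∃ t ∈ TC, n₂ = m * n₁ * t

/-- p. 14: «In particular, `𝒟(T)` is finite since `Norm(M, T)∕T` is isomorphic to the Weyl group of `(𝔪, 𝔱)`.»  PREDICATE on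
print's data. [cite: Shelstad1979, §2 (p. 14)] -/
def Shelstad1979_2_5_finite (σ : GC ≃* GC) (TC : Subgroup GC) : Prop :=
  (scriptD σ TC).Finite

end ScriptA

/-! ## §2, pp. 13–15: inner forms, the embeddings `ψ_x`, `ψᵗ : t(G) → t(G')` -/

section InnerForms

variable {GC : Type u} [Group GC] {GC' : Type u'} [Group GC']

/-- An inner automorphism of `G'(ℂ)` («`ψ̄ψ⁻¹` is inner», p. 13). [cite: Shelstad1979, §2 (p. 13)] -/
def IsInner (f : GC' → GC') : Prop :=
  ∃ u : GC', ∀ g, f g = u * g * u⁻¹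

/-- `ψ̄ = σ' ∘ ψ ∘ σ⁻¹`, the complex conjugate of the isomorphism `ψ : G → G'` (p. 13: «the bar denotes the action of complex
conjugation»). [cite: Shelstad1979, §2 (p. 13)] -/
def barIso (σ : GC ≃* GC) (σ' : GC' ≃* GC') (ψ : GC ≃* GC') : GC ≃* GC' :=
  σ.symm.trans (ψ.trans σ')

/-- «`G` is an inner form of `G'` if there exists an isomorphism `ψ : G → G'` for which `ψ̄ψ⁻¹` is inner» (p. 13) — the
condition on the FIXED `ψ` of the paper. [cite: Shelstad1979, §2 (p. 13)] -/
def IsInnerFormVia (σ : GC ≃* GC) (σ' : GC' ≃* GC') (ψ : GC ≃* GC') : Prop :=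
  IsInner (fun g' => barIso σ σ' ψ (ψ.symm g'))

/-- `ψ_x = ad x ∘ ψ` for `x ∈ G'` (p. 13: «the restriction of `ad x ∘ ψ` to `T`, which we denote by `ψ_x`»).
[cite: Shelstad1979, §2 (p. 13)] -/
def psiX (ψ : GC ≃* GC') (x : GC') : GC →* GC' :=
  (MulAut.conj x).toMonoidHom.comp ψ.toMonoidHom

/-- Unfolding of `psiX`: `ψ_x(g) = x ψ(g) x⁻¹` (p. 13). [cite: Shelstad1979, §2 (p. 13)] -/
@[simp] theorem psiX_apply (ψ : GC ≃* GC') (x : GC') (g : GC) : psiX ψ x g = x * ψ g * x⁻¹ := rfl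

/-- The lemma of [18] (p. 13): «if `T` is a maximal torus in `G` defined over `ℝ` then there exists `x ∈ G'` (depending on `T`)
such that … `ψ_x` [restricted to `T`] is defined over `ℝ`; `ψ_x(T)` is a Cartan subgroup of `G'`.»  PREDICATE on print's data
`(σ, σ', ψ, T)`. [cite: Shelstad1979, §2 (p. 13)] -/
def Shelstad1979_2_embedCartan (σ : GC ≃* GC) (σ' : GC' ≃* GC') (ψ : GC ≃* GC') (TC : Subgroup GC) : Prop :=
  ∃ x : GC', IsDefinedOverOn σ σ' (psiX ψ x) TC

/-- p. 14: «Returning to the map `ψ_x : T ↪ G'`, let `T' = ψ_x(T)`. Note that if `y ∈ G'` then `ψ_y∣T` is defined over `ℝ` if and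
only if `yx⁻¹ ∈ 𝒜(T')`.»  CLOSED (formal in the dress; proved below). [cite: Shelstad1979, §2 (p. 14)] -/
def Shelstad1979_2_psiY_iff : Prop :=
  ∀ {GC : Type u} [Group GC] {GC' : Type u'} [Group GC'] (σ : GC ≃* GC) (σ' : GC' ≃* GC') (ψ : GC ≃* GC')
    (TC : Subgroup GC) (x y : GC'), IsDefinedOverOn σ σ' (psiX ψ x) TC →
    (IsDefinedOverOn σ σ' (psiX ψ y) TC ↔ y * x⁻¹ ∈ scriptA σ' (TC.map (psiX ψ x)))

/-- pp. 14–15: «Corollary 2.3, applied twice, then shows that `ψᵗ : ⟨T⟩ → ⟨T'⟩` is a well-defined embedding of `t(G)` into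
`t(G')`, independent of the choices for `x`» — WELL-DEFINEDNESS: two admissible `x`, `y` give `G'`-conjugate tori.  PREDICATE
on print's data. [cite: Shelstad1979, §2 (pp. 14–15)] -/
def Shelstad1979_2_psiT_wellDefined (σ : GC ≃* GC) (σ' : GC' ≃* GC') (ψ : GC ≃* GC') (TC : Subgroup GC)
    (x y : GC') : Prop :=
  IsDefinedOverOn σ σ' (psiX ψ x) TC → IsDefinedOverOn σ σ' (psiX ψ y) TC →
    ∃ h ∈ realPoints σ', TC.map (psiX ψ y) = (TC.map (psiX ψ x)).map (MulAut.conj h).toMonoidHom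

/-- pp. 14–15, the same sentence — INJECTIVITY of `ψᵗ`: if the images of `T₁`, `T₂` are `G'`-conjugate then `T₁`, `T₂` are
`G`-conjugate.  PREDICATE on print's data. [cite: Shelstad1979, §2 (pp. 14–15)] -/
def Shelstad1979_2_psiT_injective (σ : GC ≃* GC) (σ' : GC' ≃* GC') (ψ : GC ≃* GC') (TC₁ TC₂ : Subgroup GC)
    (x₁ x₂ : GC') : Prop :=
  IsDefinedOverOn σ σ' (psiX ψ x₁) TC₁ → IsDefinedOverOn σ σ' (psiX ψ x₂) TC₂ →
    (∃ h' ∈ realPoints σ', TC₂.map (psiX ψ x₂) = (TC₁.map (psiX ψ x₁)).map (MulAut.conj h').toMonoidHom) →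
      ∃ h ∈ realPoints σ, TC₂ = TC₁.map (MulAut.conj h).toMonoidHom

/-- The partial order on `t(G)` (p. 13): «`⟨T₁⟩ ≤ ⟨T₂⟩` if and only if `S(T₁') ⊂ S(T₂')` for some `T₁' ∈ ⟨T₁⟩, T₂' ∈ ⟨T₂⟩`»,
with `SC` = «`T ↦ S(T)`, the maximal `ℝ`-split torus in `T`» (a PARAMETER) and `G`-conjugates of the tori.
[cite: Shelstad1979, §2 (p. 13)] -/
def cartanLE (σ : GC ≃* GC) (SC : Subgroup GC → Subgroup GC) (TC₁ TC₂ : Subgroup GC) : Prop :=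
  ∃ g₁ ∈ realPoints σ, ∃ g₂ ∈ realPoints σ,
    SC (TC₁.map (MulAut.conj g₁).toMonoidHom) ≤ SC (TC₂.map (MulAut.conj g₂).toMonoidHom)

end InnerForms

/-! ## §2, pp. 15–16: roots, Cayley transforms, Proposition 2.7, Lemma 2.8, Corollary 2.9 -/

section Cayley

variable {GC : Type u} [Group GC] {GC' : Type u'} [Group GC']

/-- A rational character (e.g. a root) `χ` of `T`, read as a function on `T(ℂ)`, is **real** iff it is fixed by the Galois action
`(σ·χ)(t) = conj (χ(σ⁻¹t))`, i.e. `χ(σ t) = conj (χ t)` on `T(ℂ)` (p. 12: «we follow the usual definitions of real, imaginary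
(compact or noncompact) and complex roots (cf. [26])»). [cite: Shelstad1979, §2 (p. 12)] -/
def IsRealOn (σ : GC ≃* GC) (TC : Subgroup GC) (χ : GC → ℂ) : Prop :=
  ∀ t ∈ TC, χ (σ t) = starRingEnd ℂ (χ t)

/-- `χ` is **imaginary** on `T` iff `σ·χ = −χ` (written multiplicatively: `χ(σ t) · conj (χ t) = 1` on `T(ℂ)`), p. 12 ∕ p. 15
(«Let `α` be an imaginary root for `T` (that is, a root in `M`)»). [cite: Shelstad1979, §2 (pp. 12, 15)] -/
def IsImaginaryOn (σ : GC ≃* GC) (TC : Subgroup GC) (χ : GC → ℂ) : Prop :=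
  ∀ t ∈ TC, χ (σ t) * starRingEnd ℂ (χ t) = 1

/-- `χ` is **complex** on `T` iff it is neither real nor imaginary (p. 12). [cite: Shelstad1979, §2 (p. 12)] -/
def IsComplexOn (σ : GC ≃* GC) (TC : Subgroup GC) (χ : GC → ℂ) : Prop :=
  ¬ IsRealOn σ TC χ ∧ ¬ IsImaginaryOn σ TC χ

/-- **Cayley transform** (p. 15): «Suppose that `T` is a Cartan subgroup of `G` and `α` a noncompact imaginary root of `T`. Then
we call `s ∈ G` a Cayley transform with respect to `α` if `s̄⁻¹s` realizes the Weyl reflection with respect to `α`.»  Here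
`wα` = the reflection `ω_α` as a map on `T(ℂ)` and `s̄ = σ s`. [cite: Shelstad1979, §2 (p. 15)] -/
def IsCayleyTransform (σ : GC ≃* GC) (TC : Subgroup GC) (wα : GC → GC) (s : GC) : Prop :=
  Realizes TC wα ((σ s)⁻¹ * s)

/-- `T_s = sTs⁻¹` (Prop. 2.7 (1), p. 15), on complex points. [cite: Shelstad1979, Proposition 2.7 (p. 15)] -/
def cayleyTorus (s : GC) (TC : Subgroup GC) : Subgroup GC :=
  TC.map (MulAut.conj s).toMonoidHom

/-- The matrix `(1∕√2) (1, −i; −i, 1)` (p. 15): «If `s` is the image of [it] under a homomorphism `SL₂ → G` of the type described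
above, then we will call `s` a standard Cayley transform.» [cite: Shelstad1979, §2 (p. 15)] -/
def cayleyMatrix : Matrix (Fin 2) (Fin 2) ℂ :=
  !![((Real.sqrt 2 : ℝ) : ℂ)⁻¹, -Complex.I * ((Real.sqrt 2 : ℝ) : ℂ)⁻¹;
     -Complex.I * ((Real.sqrt 2 : ℝ) : ℂ)⁻¹, ((Real.sqrt 2 : ℝ) : ℂ)⁻¹]

/-- **Standard Cayley transform** (p. 15): `s = φ(cayleyMatrix)` for a homomorphism `φ : SL₂ → G` «of the type described above»
(p. 15: defined over `ℝ` — `φ` intertwines entrywise complex conjugation with `σ` — and attached to the noncompact imaginary root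
`α` by `dφ : (0, −i; i, 0) ↦ H_α, ½(−i, 1; 1, i) ↦ X_α, ½(i, 1; 1, −i) ↦ X_{−α}`, a condition on the datum `φ`; `φ` is given on
all of `M₂(ℂ) ⊃ SL₂(ℂ)` to keep the matrix untyped). [cite: Shelstad1979, §2 (p. 15)] -/
def IsStandardCayley (σ : GC ≃* GC) (φ : Matrix (Fin 2) (Fin 2) ℂ → GC) (s : GC) : Prop :=
  (∀ A : Matrix (Fin 2) (Fin 2) ℂ, A.det = 1 → φ (A.map (starRingEnd ℂ)) = σ (φ A)) ∧ s = φ cayleyMatrix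

/-- **Proposition 2.7 (1)**, first clause (p. 15): «`T_s = sTs⁻¹` is defined over `ℝ`» — for a `σ`-stable `T` and a Cayley
transform `s`, `σ(T_s) ⊂ T_s`.  CLOSED (formal: `σ s = s (s̄⁻¹s)⁻¹` with `s̄⁻¹s ∈ Norm(T)`; proved below).
[cite: Shelstad1979, Proposition 2.7 (p. 15)] -/
def Shelstad1979_2_7_1_torusDefinedOver : Prop :=
  ∀ {GC : Type u} [Group GC] (σ : GC ≃* GC) (TC : Subgroup GC) (wα : GC → GC) (s : GC),
    (∀ t ∈ TC, σ t ∈ TC) → IsCayleyTransform σ TC wα s → ∀ u ∈ cayleyTorus s TC, σ u ∈ cayleyTorus s TC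

/-- **Proposition 2.7 (1)**, second clause (p. 15): «… and the root `sα` is real» — `sα = α ∘ Ad s⁻¹` on `T_s`.  CLOSED in the
dress, with print's standing hypotheses explicit: `T` is `σ`-stable, `ω_α` is an involution of `T` inverting `α`
(`α(ω_α t) α(t) = 1`), `α` is imaginary; proved below. [cite: Shelstad1979, Proposition 2.7 (p. 15)] -/
def Shelstad1979_2_7_1_rootReal : Prop :=
  ∀ {GC : Type u} [Group GC] (σ : GC ≃* GC) (TC : Subgroup GC) (wα : GC → GC) (α : GC → ℂ) (s : GC),
    (∀ t ∈ TC, σ t ∈ TC) → (∀ t ∈ TC, wα t ∈ TC) → (∀ t ∈ TC, wα (wα t) = t) → (∀ t ∈ TC, α (wα t) * α t = 1) →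
    IsImaginaryOn σ TC α → IsCayleyTransform σ TC wα s →
    IsRealOn σ (cayleyTorus s TC) (fun u => α (s⁻¹ * u * s))

/-- **Proposition 2.7 (2)** (p. 15): «the restriction of `ad s` to `S(T)` is defined over `ℝ`», `SC` = «`S(T)`, the maximal
`ℝ`-split torus in `T`» (parameter).  PREDICATE on print's data. [cite: Shelstad1979, Proposition 2.7 (p. 15)] -/
def Shelstad1979_2_7_2_splitPart (σ : GC ≃* GC) (SC : Subgroup GC) (s : GC) : Prop :=
  IsDefinedOverOn σ σ (fun t => s * t * s⁻¹) SC

/-- **Proposition 2.7 (3)** (p. 15), AS PRINTED: «if `s'` is also a Cayley transform with respect to `α` then `s's ∈ 𝒜(T_s)`.»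
PREDICATE on print's data. [cite: Shelstad1979, Proposition 2.7 (p. 15)] -/
def Shelstad1979_2_7_3_product (σ : GC ≃* GC) (TC : Subgroup GC) (wα : GC → GC) (s s' : GC) : Prop :=
  IsCayleyTransform σ TC wα s → IsCayleyTransform σ TC wα s' → s' * s ∈ scriptA σ (cayleyTorus s TC)

/-- Iterated Cayley transforms `(…((T_{s₁})_{s₂})…)_{s_n}` (p. 16). [cite: Shelstad1979, §2 (p. 16)] -/
def cayleyChain (TC : Subgroup GC) : List GC → Subgroup GC
  | [] => TC
  | s :: l => cayleyChain (cayleyTorus s TC) l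

/-- p. 16: «A straightforward argument then shows that `⟨T⟩ ≤ ⟨U⟩` if and only if there is a sequence `s₁, …, s_n` of Cayley
transforms such that `U = (…((T_{s₁})_{s₂})…)_{s_n}`.»  PREDICATE on print's data: `SC` = `T ↦ S(T)` (for the order
`cartanLE`), `IsCT V s` = «`s` is a Cayley transform for the Cartan subgroup `V(ℝ)` with respect to some noncompact imaginary
root of `V`» (parameter; the chain condition is imposed torus by torus). [cite: Shelstad1979, §2 (p. 16)] -/
def Shelstad1979_2_le_iff_cayleyChain (σ : GC ≃* GC) (SC : Subgroup GC → Subgroup GC)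
    (IsCT : Subgroup GC → GC → Prop) (TC UC : Subgroup GC) : Prop :=
  cartanLE σ SC TC UC ↔
    ∃ l : List GC, (∀ i : Fin l.length, IsCT (cayleyChain TC (l.take i)) (l.get i)) ∧ UC = cayleyChain TC l

variable (σ : GC ≃* GC) (σ' : GC' ≃* GC') (ψ : GC ≃* GC')

/-- «`⟨T'⟩` is in the image of `ψᵗ`» (p. 16): `T'` is `G'`-conjugate to `ψ_x(T)` for some maximal torus `T` of `G` defined over
`ℝ` (`𝒯` = the set of those, a PARAMETER) and some `x` with `ψ_x∣T` defined over `ℝ`. [cite: Shelstad1979, Lemma 2.8 (p. 16)] -/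
def InImagePsiT (𝒯 : Set (Subgroup GC)) (TC' : Subgroup GC') : Prop :=
  ∃ TC ∈ 𝒯, ∃ x : GC', IsDefinedOverOn σ σ' (psiX ψ x) TC ∧
    ∃ h ∈ realPoints σ', TC' = (TC.map (psiX ψ x)).map (MulAut.conj h).toMonoidHom

/-- **Lemma 2.8 (1)** (p. 16): «if `⟨T⟩ ≤ ⟨U⟩` then `ψᵗ(⟨T⟩) ≤ ψᵗ(⟨U⟩)`.»  PREDICATE on print's data (`SC`, `SC'` = the split
parts on the two sides; `x`, `y` admissible for `T`, `U`). [cite: Shelstad1979, Lemma 2.8 (p. 16)] -/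
def Shelstad1979_2_8_1_monotone (SC : Subgroup GC → Subgroup GC) (SC' : Subgroup GC' → Subgroup GC')
    (TC UC : Subgroup GC) (x y : GC') : Prop :=
  IsDefinedOverOn σ σ' (psiX ψ x) TC → IsDefinedOverOn σ σ' (psiX ψ y) UC → cartanLE σ SC TC UC →
    cartanLE σ' SC' (TC.map (psiX ψ x)) (UC.map (psiX ψ y))

/-- **Lemma 2.8 (2)** (p. 16): «if `⟨U'⟩` is in the image of `ψᵗ` and `⟨T'⟩ ≤ ⟨U'⟩` then `⟨T'⟩` is in the image of `ψᵗ`» (the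
image is an initial segment, p. 13).  PREDICATE on print's data (`𝒯'` = the maximal tori of `G'` defined over `ℝ`).
[cite: Shelstad1979, Lemma 2.8 (p. 16)] -/
def Shelstad1979_2_8_2_initialSegment (𝒯 : Set (Subgroup GC)) (𝒯' : Set (Subgroup GC'))
    (SC' : Subgroup GC' → Subgroup GC') (TC' UC' : Subgroup GC') : Prop :=
  TC' ∈ 𝒯' → UC' ∈ 𝒯' → InImagePsiT σ σ' ψ 𝒯 UC' → cartanLE σ' SC' TC' UC' → InImagePsiT σ σ' ψ 𝒯 TC'

/-- **Lemma 2.8 (3)** (p. 16): «the image under `ψᵗ` of the class of fundamental Cartan subgroups in `G` is the class of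
fundamental Cartan subgroups in `G'`» («a Cartan subgroup is fundamental if and only if it has no real roots [26]»; `IsFund`,
`IsFund'` are these predicates on the two sides, PARAMETERS).  PREDICATE on print's data. [cite: Shelstad1979, Lemma 2.8 (p. 16)] -/
def Shelstad1979_2_8_3_fundamental (IsFund : Subgroup GC → Prop) (IsFund' : Subgroup GC' → Prop) (TC : Subgroup GC)
    (x : GC') : Prop :=
  IsFund TC → IsDefinedOverOn σ σ' (psiX ψ x) TC → IsFund' (TC.map (psiX ψ x))

/-- **Corollary 2.9** (p. 16): «`G` contains a compact Cartan subgroup if and only if `G'` contains a compact Cartan subgroup.»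
A Cartan subgroup `T` is compact iff `S(T)` is trivial; PREDICATE on print's data (`𝒯`, `𝒯'` the maximal tori defined over `ℝ`,
`SC`, `SC'` the split parts). [cite: Shelstad1979, Corollary 2.9 (p. 16)] -/
def Shelstad1979_2_9_compactCartan (𝒯 : Set (Subgroup GC)) (𝒯' : Set (Subgroup GC')) (SC : Subgroup GC → Subgroup GC)
    (SC' : Subgroup GC' → Subgroup GC') : Prop :=
  (∃ TC ∈ 𝒯, SC TC = ⊥) ↔ ∃ TC' ∈ 𝒯', SC' TC' = ⊥

end Cayley

/-! ## §2, p. 16: regular elements and «`γ'` originates from `γ`» -/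

section Originates

variable {GC : Type u} [Group GC] {GC' : Type u'} [Group GC'] (σ : GC ≃* GC) (σ' : GC' ≃* GC') (ψ : GC ≃* GC')

/-- **«`γ' ∈ G'` originates from `γ` in `G_reg`»** (p. 16): «if there exists `x ∈ G'` such that `ψ_x(γ) = γ'` and `ψ_x : T_γ → T_{γ'}`
is defined over `ℝ`», `TCγ` = «`T_γ`, the Cartan subgroup containing `γ`» (on complex points; a datum of the regular element
`γ`). [cite: Shelstad1979, §2 (p. 16)] -/
def OriginatesFrom (TCγ : Subgroup GC) (γ : GC) (γ' : GC') : Prop :=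
  ∃ x : GC', psiX ψ x γ = γ' ∧ IsDefinedOverOn σ σ' (psiX ψ x) TCγ

/-- p. 16: «Then `γ'` also originates from any element `γ^w = wγw⁻¹`, `w ∈ 𝒜(T_γ)`» (with `T_{γ^w} = wT_γw⁻¹`).  CLOSED (formal;
proved below). [cite: Shelstad1979, §2 (p. 16)] -/
def Shelstad1979_2_originates_conj : Prop :=
  ∀ {GC : Type u} [Group GC] {GC' : Type u'} [Group GC'] (σ : GC ≃* GC) (σ' : GC' ≃* GC') (ψ : GC ≃* GC')
    (TCγ : Subgroup GC) (γ : GC) (γ' : GC'), ∀ w ∈ scriptA σ TCγ, OriginatesFrom σ σ' ψ TCγ γ γ' →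
    OriginatesFrom σ σ' ψ (TCγ.map (MulAut.conj w).toMonoidHom) (w * γ * w⁻¹) γ'

/-- p. 16: «… these are the only elements in `G` from which `γ'` originates.»  PREDICATE on print's data: `torusOf δ` = `T_δ` for
the regular `δ` (parameter), `reg` = `G_reg`. [cite: Shelstad1979, §2 (p. 16)] -/
def Shelstad1979_2_originates_only (reg : Set GC) (torusOf : GC → Subgroup GC) (γ : GC) (γ' : GC') : Prop :=
  γ ∈ reg → OriginatesFrom σ σ' ψ (torusOf γ) γ γ' → ∀ δ ∈ reg, OriginatesFrom σ σ' ψ (torusOf δ) δ γ' →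
    ∃ w ∈ scriptA σ (torusOf γ), δ = w * γ * w⁻¹

/-- p. 16: «Similarly, if `γ'` originates from `γ` then so also does `(γ')^{w'}` for any `w' ∈ 𝒜(T_{γ'})`», `T_{γ'} = ψ_x(T_γ)`.
CLOSED (formal; proved below). [cite: Shelstad1979, §2 (p. 16)] -/
def Shelstad1979_2_originates_conj' : Prop :=
  ∀ {GC : Type u} [Group GC] {GC' : Type u'} [Group GC'] (σ : GC ≃* GC) (σ' : GC' ≃* GC') (ψ : GC ≃* GC')
    (TCγ : Subgroup GC) (γ : GC) (x : GC'), IsDefinedOverOn σ σ' (psiX ψ x) TCγ →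
    ∀ w' ∈ scriptA σ' (TCγ.map (psiX ψ x)), OriginatesFrom σ σ' ψ TCγ γ (w' * psiX ψ x γ * w'⁻¹)

/-- p. 16: «… but these are the only such elements» (the `δ' ∈ G'` originating from `γ` are the `(γ')^{w'}`, `w' ∈ 𝒜(T_{γ'})`).
PREDICATE on print's data (`torusOf' δ'` = `T_{δ'}`). [cite: Shelstad1979, §2 (p. 16)] -/
def Shelstad1979_2_originates_only' (torusOf : GC → Subgroup GC) (torusOf' : GC' → Subgroup GC') (γ : GC)
    (γ' : GC') : Prop :=
  OriginatesFrom σ σ' ψ (torusOf γ) γ γ' → ∀ δ' : GC', OriginatesFrom σ σ' ψ (torusOf γ) γ δ' →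
    ∃ w' ∈ scriptA σ' (torusOf' γ'), δ' = w' * γ' * w'⁻¹

end Originates

/-! ## §3 «Characters», pp. 16–20 -/

section Characters

/-- The data of §3 for one group `G` (pp. 16–18), DATA ONLY: `Rep` = `Π(G)`, «the set of infinitesimal equivalence classes of
irreducible admissible representations of `G`»; `Param` = `Φ(G)` [18]; `packet φ` = `Π_φ`; `tempered` ⊂ `Π(G)`; `char π` = the
character `χ(π)` as a function on `G_reg` (p. 18, «cf. [6]»); `charPhi φ` = `χ_φ`, «the character of `π_φ = Ind(π_φ° ⊗ 1_{N₀})`»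
(p. 18), again as a function on `G_reg`.  `H` is the carrier of the real group `G`. [cite: Shelstad1979, §3 (pp. 16–18)] -/
structure LPacketData (H : Type u) where
  /-- `Π(G)`. -/
  Rep : Type v
  /-- `Φ(G)`. -/
  Param : Type v
  /-- `φ ↦ Π_φ`. -/
  packet : Param → Set Rep
  /-- the tempered classes. -/
  tempered : Set Rep
  /-- `π ↦ χ(π)` on `G_reg`. -/
  char : Rep → H → ℂ
  /-- `φ ↦ χ_φ` on `G_reg`. -/
  charPhi : Param → H → ℂ

variable {H : Type u} {H' : Type u'}

/-- «if [all the classes in `Π_φ` are tempered] then we call `φ` tempered» (p. 17). [cite: Shelstad1979, §3 (p. 17)] -/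
def LPacketData.IsTemperedParam (D : LPacketData.{u, v} H) (φ : D.Param) : Prop :=
  ∀ π ∈ D.packet φ, π ∈ D.tempered

/-- p. 16: «According to [18] there is a space `Φ(G)` which partitions `Π(G)` into finite subsets `Π_φ`, `φ ∈ Φ(G)`.»  PREDICATE on
the carrier. [cite: Shelstad1979, §3 (p. 16)] -/
def Shelstad1979_3_packets_partition (D : LPacketData.{u, v} H) : Prop :=
  (∀ π : D.Rep, ∃! φ : D.Param, π ∈ D.packet φ) ∧ ∀ φ : D.Param, (D.packet φ).Finite

/-- pp. 16–17: «Either all the classes in `Π_φ` are tempered or none is [18, page 40].»  PREDICATE on the carrier.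
[cite: Shelstad1979, §3 (pp. 16–17)] -/
def Shelstad1979_3_tempered_allOrNone (D : LPacketData.{u, v} H) : Prop :=
  ∀ φ : D.Param, (∀ π ∈ D.packet φ, π ∈ D.tempered) ∨ ∀ π ∈ D.packet φ, π ∉ D.tempered

/-- p. 17: «The map `ψ : G → G'` induces an embedding `Φ(G) ↪ Φ(G')` which we denote by `φ ↦ φ'`; `φ'` is tempered if and only if
`φ` is tempered.»  PREDICATE on the carriers and the map `paramMap` = «`φ ↦ φ'`». [cite: Shelstad1979, §3 (p. 17)] -/
def Shelstad1979_3_paramMap_embedding (D : LPacketData.{u, v} H) (D' : LPacketData.{u', v} H')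
    (paramMap : D.Param → D'.Param) : Prop :=
  Function.Injective paramMap ∧ ∀ φ, D'.IsTemperedParam (paramMap φ) ↔ D.IsTemperedParam φ

variable {GC : Type u} [Group GC] {GC' : Type u'} [Group GC']

/-- `⟨Λ⟩ = {Λ ∘ ad g⁻¹ ; g ∈ 𝒜(T)}` for a character `Λ` on the Cartan subgroup `T` (p. 18), `Λ` read as a function on `G(ℂ)`.
[cite: Shelstad1979, §3 (p. 18)] -/
def charOrbit (σ : GC ≃* GC) (TC : Subgroup GC) (Λ : GC → ℂ) : Set (GC → ℂ) :=
  {Λ₁ | ∃ g ∈ scriptA σ TC, Λ₁ = fun t => Λ (g⁻¹ * t * g)}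

/-- `Λ' = Λ ∘ ψ_x⁻¹` on `T' = ψ_x(T)` (p. 18), as a function on `G'(ℂ)`. [cite: Shelstad1979, §3 (p. 18)] -/
def transportChar (ψ : GC ≃* GC') (x : GC') (Λ : GC → ℂ) : GC' → ℂ :=
  fun g' => Λ (ψ.symm (x⁻¹ * g' * x))

/-- p. 18: «Then there is a one-to-one correspondence between tempered parameters `φ` and such orbits `⟨Λ⟩`.»  PREDICATE on
print's data: `orbitOf` = the correspondence `φ ↦ ⟨Λ⟩` [18] (parameter), `IsCharOf TC Λ` = «`Λ` is a character on the Cartan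
subgroup `T`» over the maximal tori `𝒯` defined over `ℝ` (parameters); the carrier `D` lives on the real group `realPoints σ`.
[cite: Shelstad1979, §3 (p. 18)] -/
def Shelstad1979_3_orbitCorrespondence (σ : GC ≃* GC) (D : LPacketData.{u, v} (realPoints σ))
    (𝒯 : Set (Subgroup GC)) (IsCharOf : Subgroup GC → (GC → ℂ) → Prop) (orbitOf : D.Param → Set (GC → ℂ)) : Prop :=
  Set.InjOn orbitOf {φ | D.IsTemperedParam φ} ∧
    orbitOf '' {φ | D.IsTemperedParam φ} = {O | ∃ TC ∈ 𝒯, ∃ Λ, IsCharOf TC Λ ∧ O = charOrbit σ TC Λ}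

/-- p. 18: «The map `φ ↦ φ'` on parameters induces the following map of orbits. If `Λ` is defined on `T` pick `x ∈ G'` such that
`ψ_x : T → G'` is defined over `ℝ`. Then `⟨Λ⟩ ↦ ⟨Λ'⟩` where `Λ' = Λ ∘ ψ_x⁻¹`.»  PREDICATE on print's data.
[cite: Shelstad1979, §3 (p. 18)] -/
def Shelstad1979_3_orbitTransport (σ : GC ≃* GC) (σ' : GC' ≃* GC') (ψ : GC ≃* GC')
    (D : LPacketData.{u, v} (realPoints σ)) (D' : LPacketData.{u', v} (realPoints σ'))
    (paramMap : D.Param → D'.Param) (orbitOf : D.Param → Set (GC → ℂ)) (orbitOf' : D'.Param → Set (GC' → ℂ))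
    (TC : Subgroup GC) (Λ : GC → ℂ) (x : GC') (φ : D.Param) : Prop :=
  IsDefinedOverOn σ σ' (psiX ψ x) TC → orbitOf φ = charOrbit σ TC Λ →
    orbitOf' (paramMap φ) = charOrbit σ' (TC.map (psiX ψ x)) (transportChar ψ x Λ)

/-- **Lemma 3.1** (p. 18): «`χ_φ = Σ_{π ∈ Π_φ} χ(π)`» (as functions on `G_reg`; «each `π` in `Π_φ` occurs in `π_φ` with
multiplicity one»).  PREDICATE on the carrier (`∑ᶠ` over the finite packet). [cite: Shelstad1979, Lemma 3.1 (p. 18)] -/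
def Shelstad1979_3_1_charSum (D : LPacketData.{u, v} H) : Prop :=
  ∀ (φ : D.Param) (g : H), D.charPhi φ g = ∑ᶠ π ∈ D.packet φ, D.char π g

/-- The data of **Lemma 3.2** (p. 18), DATA ONLY: `RepM` = the (classes of) square-integrable irreducible admissible
representations `σ` of the Levi subgroup `M`; `LEquiv` = `L`-equivalence on them; `IndRep` = classes of admissible
representations of `G` up to infinitesimal equivalence; `indN σ` = the class of `Ind(σ ⊗ 1_N)`. [cite: Shelstad1979, Lemma 3.2 (p. 18)] -/
structure IndData where
  /-- square-integrable classes of `M`. -/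
  RepM : Type v
  /-- `L`-equivalence. -/
  LEquiv : RepM → RepM → Prop
  /-- representations of `G` up to infinitesimal equivalence. -/
  IndRep : Type v
  /-- `σ ↦ Ind(σ ⊗ 1_N)`. -/
  indN : RepM → IndRep

/-- **Lemma 3.2** (p. 18): «If `σ` and `σ'` are `L`-equivalent square-integrable irreducible admissible representations of `M` then
`Ind(σ ⊗ 1_N)` is infinitesimally equivalent to `Ind(σ' ⊗ 1_N)` if and only if `σ` is infinitesimally equivalent to `σ'`.»
PREDICATE on the carrier. [cite: Shelstad1979, Lemma 3.2 (p. 18)] -/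
def Shelstad1979_3_2_inducedEquivalent (I : IndData.{v}) : Prop :=
  ∀ s s' : I.RepM, I.LEquiv s s' → (I.indN s = I.indN s' ↔ s = s')

/-- Display **(1)** (p. 19, proof of Lemma 3.2): «`g(λ + ι) = ω₀ω(λ + ι)`» in `𝔱†*` — `g`, `ω₀`, `ω` acting linearly on the dual
`V` of the Lie algebra of `T†`, `lam` = `λ` (the differential of `Λ∣T†`), `iota` = `ι`.  PREDICATE on explicit data.
[cite: Shelstad1979, §3 (1) (p. 19)] -/
def Shelstad1979_3_eq_1 {V : Type v} [AddCommGroup V] [Module ℂ V] (g ω₀ ω : V →ₗ[ℂ] V) (lam iota : V) : Prop :=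
  g (lam + iota) = ω₀ (ω (lam + iota))

/-- p. 20: «`2q_G` is the dimension of the symmetric space attached to the simply-connected covering of the derived group of `G`.
Note that `q_{G'} − q_G` is an integer (cf. [26, volume 2, page 225]).»  PREDICATE on the data `twoQ = 2q_G`, `twoQ' = 2q_{G'}`.
[cite: Shelstad1979, §3 (p. 20)] -/
def Shelstad1979_3_qDiff_integer (twoQ twoQ' : ℕ) : Prop :=
  Even ((twoQ' : ℤ) - (twoQ : ℤ))

/- The character identity announced at the end of §3 (pp. 19–20: «`χ_{φ'}(γ') = (−1)^{q_{G'} − q_G} χ_φ(γ)`, `γ' ∈ G'_reg`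
originating from `γ ∈ G_reg`») IS Theorem 6.3 and is typed ONCE, in the sibling ★
`Literature.NumberTheory.Automorphic.Shelstad1979.Correspondences.Shelstad1979_6_3_characterIdentity` (with the sign
★ `…Correspondences.InnerFormSetting.transferSign`); it is cited here, not restated. -/

end Characters

/-! ## Discharges — proofs of the CLOSED facts above (every statement above is as printed; the proofs are formal in the dress) -/

section Discharges

/-- Proof of `Shelstad1979_2_scriptA_subset` (p. 13): for `g ∈ 𝒜(T)` and `t ∈ T = T(ℝ)`, `σ(gtg⁻¹) = gσ(t)g⁻¹ = gtg⁻¹`.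
[cite: Shelstad1979, §2 (p. 13)] -/
theorem Shelstad1979_2_scriptA_subset_holds : Shelstad1979_2_scriptA_subset.{u} := by
  intro GC _ σ TC g hg t ht
  rw [cartan, Subgroup.mem_inf] at ht
  rw [mem_realPoints, ← hg t ht.1, mem_realPoints.mp ht.2]

/-- Proof of `Shelstad1979_2_2_anisotropicAut` (Prop. 2.2, p. 14): an additive automorphism commutes with `−1`.
[cite: Shelstad1979, Proposition 2.2 (p. 14)] -/
theorem Shelstad1979_2_2_anisotropicAut_holds : Shelstad1979_2_2_anisotropicAut.{v} := by
  intro L _ σL hσ φ l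
  rw [hσ, hσ, map_neg]

/-- Proof of `Shelstad1979_2_psiY_iff` (p. 14): `ψ_y = ad(yx⁻¹) ∘ ψ_x`, and `ψ_x` intertwines `σ` with `σ'` on `T`.
[cite: Shelstad1979, §2 (p. 14)] -/
theorem Shelstad1979_2_psiY_iff_holds : Shelstad1979_2_psiY_iff.{u, u'} := by
  intro GC _ GC' _ σ σ' ψ TC x y hx
  constructor
  · intro hy t' ht'
    obtain ⟨t, ht, rfl⟩ := Subgroup.mem_map.mp ht'
    have h1 := hx t ht
    have h2 := hy t ht
    simp only [psiX_apply] at h1 h2 ⊢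
    -- `(yx⁻¹) σ'(xψ(t)x⁻¹) (yx⁻¹)⁻¹ = y ψ(σt) y⁻¹ = σ'(y ψ(t) y⁻¹) = σ'((yx⁻¹)(xψ(t)x⁻¹)(yx⁻¹)⁻¹)`
    rw [← h1, show y * x⁻¹ * (x * ψ t * x⁻¹) * (y * x⁻¹)⁻¹ = y * ψ t * y⁻¹ by group, ← h2]
    group
  · intro hyx t ht
    have h1 := hx t ht
    have h3 := hyx (psiX ψ x t) (Subgroup.mem_map_of_mem _ ht)
    simp only [psiX_apply] at h1 h3 ⊢
    rw [← h1, show y * x⁻¹ * (x * ψ t * x⁻¹) * (y * x⁻¹)⁻¹ = y * ψ t * y⁻¹ by group] at h3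
    rw [show y * ψ (σ t) * y⁻¹ = y * x⁻¹ * (x * ψ (σ t) * x⁻¹) * (y * x⁻¹)⁻¹ by group, h3]

/-- Proof of `Shelstad1979_2_7_1_torusDefinedOver` (Prop. 2.7 (1), p. 15): with `n = s̄⁻¹s ∈ Norm(T)`, `σ(sts⁻¹) =
s (n⁻¹ σ(t) n) s⁻¹ ∈ sTs⁻¹`. [cite: Shelstad1979, Proposition 2.7 (p. 15)] -/
theorem Shelstad1979_2_7_1_torusDefinedOver_holds : Shelstad1979_2_7_1_torusDefinedOver.{u} := by
  intro GC _ σ TC wα s hT hs u hu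
  obtain ⟨t, ht, rfl⟩ := Subgroup.mem_map.mp hu
  obtain ⟨hn, -⟩ := hs
  rw [cayleyTorus, Subgroup.mem_map]
  -- the element `n⁻¹ σ(t) n` of `T`, `n = (σ s)⁻¹ * s`
  refine ⟨((σ s)⁻¹ * s)⁻¹ * σ t * ((σ s)⁻¹ * s), (Subgroup.mem_normalizer_iff''.mp hn (σ t)).mp (hT t ht), ?_⟩
  simp only [MulEquiv.coe_toMonoidHom, MulAut.conj_apply, map_mul, map_inv]
  group

/-- Proof of `Shelstad1979_2_7_1_rootReal` (Prop. 2.7 (1), p. 15): for `u = sts⁻¹`, `s⁻¹σ(u)s = n⁻¹σ(t)n = ω_α(σ t)` and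
`α(ω_α σt) = α(σt)⁻¹ = conj α(t)`. [cite: Shelstad1979, Proposition 2.7 (p. 15)] -/
theorem Shelstad1979_2_7_1_rootReal_holds : Shelstad1979_2_7_1_rootReal.{u} := by
  intro GC _ σ TC wα α s hT hwT hww hwα hα hs u hu
  obtain ⟨t, ht, rfl⟩ := Subgroup.mem_map.mp hu
  obtain ⟨hn, hw⟩ := hs
  set n : GC := (σ s)⁻¹ * s with hndef
  have hσs : σ s = s * n⁻¹ := by rw [hndef]; group
  -- `n⁻¹ t' n = wα t'` for `t' ∈ T` (from `n t'' n⁻¹ = wα t''` and `wα` an involution of `T`)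
  have hconj : ∀ t' ∈ TC, n⁻¹ * t' * n = wα t' := by
    intro t' ht'
    have hmem : n⁻¹ * t' * n ∈ TC := (Subgroup.mem_normalizer_iff''.mp hn t').mp ht'
    have h1 := hw _ hmem
    rw [show n * (n⁻¹ * t' * n) * n⁻¹ = t' by group] at h1
    -- `h1 : t' = wα (n⁻¹ t' n)`; apply `wα`
    have h2 := congrArg wα h1
    rwa [hww _ hmem, eq_comm] at h2
  simp only [MulEquiv.coe_toMonoidHom, MulAut.conj_apply]
  rw [show s⁻¹ * (s * t * s⁻¹) * s = t by group, map_mul, map_mul, map_inv, hσs,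
    show (s * n⁻¹)⁻¹ = n * s⁻¹ by group,
    show s⁻¹ * (s * n⁻¹ * σ t * (n * s⁻¹)) * s = n⁻¹ * σ t * n by group, hconj _ (hT t ht)]
  -- `α (wα (σ t)) = conj (α t)`: both are inverse to `α (σ t)`
  have h1 : α (wα (σ t)) * α (σ t) = 1 := hwα _ (hT t ht)
  have h2 : α (σ t) * starRingEnd ℂ (α t) = 1 := hα t ht
  calc α (wα (σ t)) = α (wα (σ t)) * (α (σ t) * starRingEnd ℂ (α t)) := by rw [h2, mul_one]
    _ = α (wα (σ t)) * α (σ t) * starRingEnd ℂ (α t) := by rw [mul_assoc]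
    _ = starRingEnd ℂ (α t) := by rw [h1, one_mul]

/-- Proof of `Shelstad1979_2_originates_conj` (p. 16): if `ψ_x(γ) = γ'` with `ψ_x∣T_γ` over `ℝ` and `w ∈ 𝒜(T_γ)`, then
`x' = xψ(w)⁻¹` has `ψ_{x'}(wγw⁻¹) = γ'` and `ψ_{x'}∣wT_γw⁻¹` over `ℝ`. [cite: Shelstad1979, §2 (p. 16)] -/
theorem Shelstad1979_2_originates_conj_holds : Shelstad1979_2_originates_conj.{u, u'} := by
  intro GC _ GC' _ σ σ' ψ TCγ γ γ' w hw hγ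
  obtain ⟨x, hxγ, hx⟩ := hγ
  refine ⟨x * (ψ w)⁻¹, ?_, ?_⟩
  · rw [psiX_apply] at hxγ ⊢
    rw [← hxγ, map_mul, map_mul, map_inv]
    group
  · intro u hu
    obtain ⟨t, ht, rfl⟩ := Subgroup.mem_map.mp hu
    have h1 := hx t ht
    have h2 := hw t ht
    simp only [MulEquiv.coe_toMonoidHom, MulAut.conj_apply, psiX_apply] at h1 h2 ⊢
    have key : x * ψ (σ t) * x⁻¹ = σ' x * σ' (ψ t) * (σ' x)⁻¹ := by simpa only [map_mul, map_inv] using h1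
    rw [← h2]
    simp only [map_mul, map_inv]
    calc _ = x * ψ (σ t) * x⁻¹ := by group
      _ = σ' x * σ' (ψ t) * (σ' x)⁻¹ := key
      _ = _ := by group

/-- Proof of `Shelstad1979_2_originates_conj'` (p. 16): `ψ_{w'x}(γ) = w'γ'w'⁻¹` and, for `t ∈ T_γ`, `ψ_{w'x}(σt) = w'σ'(ψ_x t)w'⁻¹ =
σ'(w'ψ_x(t)w'⁻¹)` as `w' ∈ 𝒜(ψ_x(T_γ))`. [cite: Shelstad1979, §2 (p. 16)] -/
theorem Shelstad1979_2_originates_conj'_holds : Shelstad1979_2_originates_conj'.{u, u'} := by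
  intro GC _ GC' _ σ σ' ψ TCγ γ x hx w' hw'
  refine ⟨w' * x, ?_, ?_⟩
  · simp only [psiX_apply]
    group
  · intro t ht
    have h1 := hx t ht
    have h2 := hw' (psiX ψ x t) (Subgroup.mem_map_of_mem _ ht)
    simp only [psiX_apply] at h1 h2 ⊢
    rw [show w' * x * ψ (σ t) * (w' * x)⁻¹ = w' * (x * ψ (σ t) * x⁻¹) * w'⁻¹ by group, h1, h2]
    congr 1
    group

end Discharges

end Literature.NumberTheory.Automorphic.Shelstad1979.InnerFormsAndCharacters

end
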